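import Summits.BirchSwinnertonDyer.BirchSwinnertonDyer.Theorems.GenusKolyvaginAtTwoEquivariantKolyvaginExactAtTwoSelmerConditionVisible
import Summits.BirchSwinnertonDyer.BirchSwinnertonDyer.Theorems.GenusKolyvaginAtTwoEquivariantKolyvaginExactAtTwoPropFourFourRat
import Summits.BirchSwinnertonDyer.BirchSwinnertonDyer.Theorems.GenusKolyvaginAtTwoEquivariantKolyvaginExactAtTwoTwinDualityRat
import Summits.BirchSwinnertonDyer.BirchSwinnertonDyer.Theorems.GenusKolyvaginAtTwoEquivariantKolyvaginExactAtTwoPairBookkeeping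
import Literature.NumberTheory.EllipticCurves.HeegnerPointsKolyvaginVisibleDescentPairProofs
import Literature.NumberTheory.EllipticCurves.BSDRankZeroDensity
import HarnessLib

/-!
# Route `GenusKolyvaginAtTwo`, LINE 6, KEY crux Q3 (inner statement of stmt-BirchSwinnertonDyer-22137):
# the INSTANTIATION at `2` over `ℚ` of the visible pair descent `KolyvaginDescent.VisiblePairHypothesesM`
# (gk2-p2, p632473) — Kolyvagin's frame `(E, E^{(d_K)})` (definitions; reviewed)

Seat `bsd-line-gk2-p3` g12 (`--supports` the crux, closes nothing; kind definition). gk2-p2's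
`Literature/…/HeegnerPointsKolyvaginVisibleDescentPair(Exact)Proofs` run McCallum's §5 for an ABSTRACT visible pair
`S : VisiblePairHypothesesM V₁ V₂ Pl H` (conclusions `pow_zsmul_sel₂_eq_zero_and_sel₁_le`,
`sel₁_eq_and_card_sel₂_eq_of_primitive`, …). This file builds the CONCRETE `S` for an elliptic curve `E = W/ℚ`
(globally minimal, `Δ(E) < 0`), an imaginary quadratic `K = ℚ(θ)`, `θ² = d_K` odd, and a level `2^M`:

* `V₁ = H¹(ℚ, E[2^M])`, `V₂ = H¹(ℚ, E^{(d_K)}[2^M])` (`galH1Torsion`, twin equation `twin W K = W.quadraticTwist d_K`),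
  `Pl =` finite places `⊕` infinite places of `ℚ`, `H = (Γ_{K(E_K[2^M])} → E_K[2^M])`;
* `Sel = selmerGroup`, `Loc = selmerLocalKer` (`loc₁`, `loc₂`), `A ℓ = torsionLocalKer` at the place of `ℓ` (`a₁`,
  `a₂`), `Kol = kolPrime` (odd good `ℓ ∤ d_K`, INERT, `Frob_ℓ ∼ τ` on `E[2^M]` — Gross's (3.2) at depth `2^M` —, and
  the index-`≥ M` form used by the duality count), `pl ℓ = v_ℓ`, `Dv = (n ∈ v)`;
* `rK₁ u = (ρ ↦ [res u, ρ])`, `rK₂ y = (ρ ↦ [hPsiKT (res y), ρ])` (McCallum p. 299, restriction to `K(E[2^M])`, the twin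
  read through `E^{(d_K)}_K ≅ E_K`), `LocK ℓ =` functions vanishing on the inertia groups above `ℓ` (`locK`);
* the DERIVED axioms are this lineage's bricks: `duality₁/₂` ← `…DualityRat` / `…TwinDualityRat`,
  `mem_loc₁/₂_pl_iff` ← `…SelmerConditionVisible`, `c_mem_loc_iff₁₂/₂₁` ← `…PropFourFourRat` (from the `K`-level
  relation), `torsion` ← `zsmul_galH1Torsion_eq_zero`, `dv_*` ← `…PairBookkeeping`;
* the INPUT axioms stay displayed, bundled in `Input`: the classes `x`, `c₁`, `c₂` over `ℚ` and `c_K` over `K` with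
  `res (c₁ m) = c_K(m)` (even depth), `hPsiKT (res (c₂ m)) = c_K(m)` (odd depth) (cf. `…EigenClassesFinite`); the
  Kolyvagin relation OVER `K` at `λ ∣ ℓ` (`rel` — the conclusion of the route's Q2 `KolyvaginRelationAtTwo`, stated
  for these Kolyvagin primes); McCallum's Lemma 4.3 OVER `ℚ` for both families at every place not dividing the depth
  (`loc_c₁_*`, `loc_c₂_*` — at the odd good places unramified in `K` it follows from the `K`-statement by
  `…SelmerDescentQuadratic`; at `v ∣ d_K N`, `v = 2`, `∞` it is an honest hypothesis, cf. the DEF-prime analysis,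
  evidence #31 on the crux); the habitat condition (H2) `sel_visible`; and Cor. 3.2 in visible form (`cebotarev`,
  gk2-p2's bridge from `GenusExact.equivariantChebotarevAtTwo_signed_of_not_isSquare`).

`visiblePair I : VisiblePairHypothesesM …` is the instance; `visiblePair_Sel₁` etc. identify its data by `rfl`.
DEFINITIONS + their unfolding lemmas only; no instance, no notation, no named fact, no `sorry`. Nothing here is a
claim about BSD, about Q2, or about (H2).

References: [Kolyvagin1989Izv] §3 (the pair `(E, E^D)` over `ℚ`, Thm. B_l at l = 2); [McCallumLMS1991] p. 299,
Cor. 3.2, Lemma 4.3, Prop. 4.4, Lemma 5.3, §5; [GrossLMS1991] §3 (3.1)–(3.3), Prop. 9.1, §10.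
-/

set_option autoImplicit false
set_option linter.dupNamespace false -- tree convention: `Summit.BirchSwinnertonDyer.BirchSwinnertonDyer.Theorems` (summit = sub-problem)

noncomputable section

open scoped Classical

namespace Summit.BirchSwinnertonDyer.BirchSwinnertonDyer.Theorems.GenusExact.VisiblePairAtTwo

open WeierstrassCurve NumberField IsDedekindDomain Field Rat.HeightOneSpectrum
open Literature.NumberTheory.EllipticCurves Literature.NumberTheory.GaloisRepresentations
open Literature.NumberTheory.EllipticCurves.KolyvaginDescent
open Summit.BirchSwinnertonDyer.BirchSwinnertonDyer.Theorems.GenusExact.FrobeniusCriterion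
open Summit.BirchSwinnertonDyer.BirchSwinnertonDyer.Theorems.GenusExact.SelmerDescent
open Summit.BirchSwinnertonDyer.BirchSwinnertonDyer.Theorems.GenusExact.TwinGrossPrimes

/-! ## §1 The objects -/

section Objects

variable (W : WeierstrassCurve ℚ) (K : Type) [Field K] [NumberField K] (M : ℕ)

/-- The twin equation `E^{(d_K)} = W.quadraticTwist d_K` (Kolyvagin's `E^D`, `D = d_K`). [cite: Kolyvagin1989Izv, §3] -/
abbrev twin : WeierstrassCurve ℚ := W.quadraticTwist ((NumberField.discr K : ℤ) : ℚ)

/-- The level `2^M` as an integer. [cite: McCallumLMS1991, §5] -/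
abbrev lvl : ℤ := ((2 ^ M : ℕ) : ℤ)

/-- The common target `H = (Γ_{K(E_K[2^M])} → E_K[2^M])` of the two restriction maps (McCallum p. 299:
`H¹(K(E_{p^M}), E_{p^M}) = Hom(Gal(ℚ̄/K(E_{p^M})), E_{p^M})`, as functions on `Γ_{K(E[2^M])}`). [cite: McCallumLMS1991, p. 299] -/
abbrev HK : Type :=
  torsionFixing (W.baseChange K) (lvl M) → geomTorsion (W.baseChange K) (lvl M)

/-- The place of a natural number: `v_ℓ` for `ℓ` prime (junk `v_2` otherwise). [folklore] -/
def pl (ℓ : ℕ) : HeightOneSpectrum (𝓞 ℚ) ⊕ InfinitePlace ℚ :=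
  if h : ℓ.Prime then Sum.inl (primesEquiv.symm ⟨ℓ, h⟩) else Sum.inl (primesEquiv.symm ⟨2, Nat.prime_two⟩)

/-- "`v` divides `n`": `(n : 𝓞 ℚ) ∈ v` at a finite place, never at an infinite one. [folklore] -/
def Dv : HeightOneSpectrum (𝓞 ℚ) ⊕ InfinitePlace ℚ → ℕ → Prop :=
  fun P n ↦ Sum.elim (fun v : HeightOneSpectrum (𝓞 ℚ) ↦ (n : 𝓞 ℚ) ∈ v.asIdeal) (fun _ ↦ False) P

/-- Local conditions of `E`: `selmerLocalKer` at every place. [cite: McCallumLMS1991, §4 (Selmer group)] -/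
def loc₁ : HeightOneSpectrum (𝓞 ℚ) ⊕ InfinitePlace ℚ → AddSubgroup (galH1Torsion W (lvl M)) :=
  Sum.elim (fun v ↦ selmerLocalKer W (v.adicCompletion ℚ) (lvl M)) (fun w ↦ selmerLocalKer W w.Completion (lvl M))

/-- Local conditions of the twin `E^{(d_K)}`. [cite: McCallumLMS1991, §4 (Selmer group)] -/
def loc₂ : HeightOneSpectrum (𝓞 ℚ) ⊕ InfinitePlace ℚ → AddSubgroup (galH1Torsion (twin W K) (lvl M)) :=
  Sum.elim (fun v ↦ selmerLocalKer (twin W K) (v.adicCompletion ℚ) (lvl M))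
    (fun w ↦ selmerLocalKer (twin W K) w.Completion (lvl M))

/-- Strict condition of `E` at `ℓ`: `x_v = 0` at the place(s) `v ∋ ℓ` (`torsionLocalKer`). [cite: McCallumLMS1991, §5 Lemma 5.3] -/
def a₁ (ℓ : ℕ) : AddSubgroup (galH1Torsion W (lvl M)) :=
  ⨅ (v : HeightOneSpectrum (𝓞 ℚ)) (_ : (ℓ : 𝓞 ℚ) ∈ v.asIdeal), W.torsionLocalKer (v.adicCompletion ℚ) (lvl M)

/-- Strict condition of the twin at `ℓ`. [cite: McCallumLMS1991, §5 Lemma 5.3] -/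
def a₂ (ℓ : ℕ) : AddSubgroup (galH1Torsion (twin W K) (lvl M)) :=
  ⨅ (v : HeightOneSpectrum (𝓞 ℚ)) (_ : (ℓ : 𝓞 ℚ) ∈ v.asIdeal),
    (twin W K).torsionLocalKer (v.adicCompletion ℚ) (lvl M)

/-- The common local condition at `ℓ` read in `H`: functions on `Γ_{K(E_K[2^M])}` vanishing on the inertia group
`I_𝔔` of every prime `𝔔` of `\bar ℤ_K` above every place `w ∋ ℓ` of `K`. [cite: McCallumLMS1991, p. 299 and §4 Lemma 4.3] -/
def locK (ℓ : ℕ) : AddSubgroup (HK W K M) :=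
  ⨅ (w : HeightOneSpectrum (𝓞 K)) (_ : (ℓ : 𝓞 K) ∈ w.asIdeal) (𝔔 : Ideal (absIntegers (𝓞 K) K))
    (_ : 𝔔 ∈ w.primesAbove) (ρ : torsionFixing (W.baseChange K) (lvl M))
    (_ : (ρ : absoluteGaloisGroup K) ∈ 𝔔.inertia (absoluteGaloisGroup K)),
    (Pi.evalAddMonoidHom (fun _ ↦ geomTorsion (W.baseChange K) (lvl M)) ρ).ker

/-- `rK₁ u = (ρ ↦ [res u, ρ])`: restriction of `E`'s classes to `K(E_K[2^M])`. [cite: McCallumLMS1991, p. 299] -/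
def rK₁ : galH1Torsion W (lvl M) →+ HK W K M :=
  AddMonoidHom.pi fun ρ ↦ (h1EvalHom (W.baseChange K) (lvl M) ρ.2).comp (resTorsion W K (lvl M))

variable {K} {θ : K} (hθ : θ ∉ Set.range (algebraMap ℚ K))
  (hθsq : θ ^ 2 = algebraMap ℚ K ((NumberField.discr K : ℤ) : ℚ))

/-- `rK₂ y = (ρ ↦ [hPsiKT (res y), ρ])`: restriction of the twin's classes, through `E^{(d_K)}_K ≅ E_K` (`hPsiKT`,
`K = ℚ(θ)`, `θ² = d_K`). [cite: McCallumLMS1991, p. 299] [cite: Kolyvagin1989Izv, §3] -/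
def rK₂ : galH1Torsion (twin W K) (lvl M) →+ HK W K M :=
  AddMonoidHom.pi fun ρ ↦ (h1EvalHom (W.baseChange K) (lvl M) ρ.2).comp
    ((hPsiKT W K hθ hθsq (lvl M)).toAddMonoidHom.comp (resTorsion (twin W K) K (lvl M)))

end Objects

/-! ## §2 Kolyvagin primes and the displayed inputs -/

section Inputs

variable (W : WeierstrassCurve ℚ) [W.IsElliptic] [W.IsGloballyMinimal] (K : Type) [Field K] [NumberField K]
  (M : ℕ)

/-- **Kolyvagin primes of the instance**: `ℓ` an odd prime, `ℓ ∤ d_K`, `E` of good reduction at `ℓ`, `Frob_ℓ ∼ τ` on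
`E[2^M]` (Gross (3.2) at depth `2^M`, `FrobEqFrobInfty W K (2^M) ℓ` — the currency of the Kolyvagin-prime dictionary)
AND on `E[2]` with Kolyvagin index `≥ M` (the currency of the duality count), and `ℓ` INERT in `K` (every place of `K`
above `ℓ` has residue degree `2`). [cite: GrossLMS1991, §3 (3.1)–(3.3)] [cite: McCallumLMS1991, §3] -/
def kolPrime (ℓ : ℕ) : Prop :=
  ∃ hℓ : ℓ.Prime, ℓ ≠ 2 ∧ ¬ ((ℓ : ℤ) ∣ NumberField.discr K) ∧
    (haveI : Fact ℓ.Prime := ⟨hℓ⟩; W.HasGoodReductionAtPrime ℓ) ∧ FrobEqFrobInfty W K (2 ^ M) ℓ ∧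
    FrobEqFrobInfty W K 2 ℓ ∧ M ≤ Zhang2014.kolyvaginIndex W 2 ℓ ∧
    ∀ w : HeightOneSpectrum (𝓞 K), (ℓ : 𝓞 K) ∈ w.asIdeal → w.asIdeal.inertiaDeg (𝓞 ℚ) = 2

end Inputs


/-- **The inputs of the instance that this lineage does not derive**: field data; the classes with their descent
identities; `M₀`; the Kolyvagin relation OVER `K` (Q2's conclusion at the places of `K` above `ℓ`, clauses composed);
Lemma 4.3 OVER `ℚ` for both families; (H2); Cor. 3.2 in visible form. [cite: McCallumLMS1991, §3 Cor. 3.2, §4 Lemma 4.3 and Prop. 4.4, §5]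
[cite: Kolyvagin1989Izv, §3] -/
structure Input (W : WeierstrassCurve ℚ) [W.IsElliptic] [W.IsGloballyMinimal] (K : Type) [Field K]
    [NumberField K] (M : ℕ) {θ : K}
    (hθ : θ ∉ Set.range (algebraMap ℚ K)) (hθsq : θ ^ 2 = algebraMap ℚ K ((NumberField.discr K : ℤ) : ℚ)) where
  /-- `K` is imaginary quadratic. -/
  hK : IsImaginaryQuadratic K
  /-- `d_K` is odd. -/
  hodd : Odd (NumberField.discr K)
  /-- `Δ(E) < 0` (the habitat). -/
  hΔ : W.Δ < 0
  /-- `M ≥ 1`. -/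
  hM : 1 ≤ M
  /-- `x = δ_M x₀ ∈ H¹(ℚ, E[2^M])`. -/
  x : galH1Torsion W (lvl M)
  /-- `x` is Selmer. -/
  x_mem : x ∈ selmerGroup W (lvl M)
  /-- `x` has order `2^M`. -/
  x_ord : ((2 : ℤ) ^ (M - 1)) • x ≠ 0
  /-- `M₀`. -/
  M₀ : ℕ
  /-- Kolyvagin's descended classes of even depth (on `E`). -/
  c₁ : ℕ → galH1Torsion W (lvl M)
  /-- Kolyvagin's descended classes of odd depth (on `E^{(d_K)}`). -/
  c₂ : ℕ → galH1Torsion (twin W K) (lvl M)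
  /-- Kolyvagin's classes `c_M(n) ∈ H¹(K, E_K[2^M])`. -/
  cK : ℕ → galH1Torsion (W.baseChange K) (lvl M)
  /-- `c_M(1) = 2^{M₀} x` over `ℚ`. -/
  c_one : c₁ 1 = ((2 : ℤ) ^ M₀) • x
  /-- `res (c₁ m) = c_K(m)` at even depth. -/
  res_c₁ : ∀ m, KolSupp (kolPrime W K M) m → Even m.primeFactors.card →
    resTorsion W K (lvl M) (c₁ m) = cK m
  /-- `hPsiKT (res (c₂ m)) = c_K(m)` at odd depth. -/
  res_c₂ : ∀ m, KolSupp (kolPrime W K M) m → Odd m.primeFactors.card →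
    hPsiKT W K hθ hθsq (lvl M) (resTorsion (twin W K) K (lvl M) (c₂ m)) = cK m
  /-- **Prop. 4.4 over `K`** at the places above `ℓ`: `2^a c_K(ℓm)` Selmer at `λ` iff `2^a c_K(m)` vanishes at `λ`. -/
  rel : ∀ ℓ m, kolPrime W K M ℓ → KolSupp (kolPrime W K M) (ℓ * m) →
    ∀ w : HeightOneSpectrum (𝓞 K), (ℓ : 𝓞 K) ∈ w.asIdeal → ∀ a : ℕ,
      ((2 : ℤ) ^ a) • cK (ℓ * m) ∈ selmerLocalKer (W.baseChange K) (w.adicCompletion K) (lvl M) ↔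
        ((2 : ℤ) ^ a) • cK m ∈ (W.baseChange K).torsionLocalKer (w.adicCompletion K) (lvl M)
  /-- **Lemma 4.3 over `ℚ`**, even depth, finite places not dividing the depth. -/
  loc_c₁_fin : ∀ m, KolSupp (kolPrime W K M) m → Even m.primeFactors.card →
    ∀ v : HeightOneSpectrum (𝓞 ℚ), (m : 𝓞 ℚ) ∉ v.asIdeal → c₁ m ∈ selmerLocalKer W (v.adicCompletion ℚ) (lvl M)
  /-- Lemma 4.3 over `ℚ`, even depth, infinite place. -/
  loc_c₁_inf : ∀ m, KolSupp (kolPrime W K M) m → Even m.primeFactors.card →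
    ∀ w : InfinitePlace ℚ, c₁ m ∈ selmerLocalKer W w.Completion (lvl M)
  /-- **Lemma 4.3 over `ℚ`**, odd depth, finite places not dividing the depth. -/
  loc_c₂_fin : ∀ m, KolSupp (kolPrime W K M) m → Odd m.primeFactors.card →
    ∀ v : HeightOneSpectrum (𝓞 ℚ), (m : 𝓞 ℚ) ∉ v.asIdeal →
      c₂ m ∈ selmerLocalKer (twin W K) (v.adicCompletion ℚ) (lvl M)
  /-- Lemma 4.3 over `ℚ`, odd depth, infinite place. -/
  loc_c₂_inf : ∀ m, KolSupp (kolPrime W K M) m → Odd m.primeFactors.card →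
    ∀ w : InfinitePlace ℚ, c₂ m ∈ selmerLocalKer (twin W K) w.Completion (lvl M)
  /-- **(H2)**: the pair Selmer group is visible in `H`. -/
  sel_visible : ∀ s₁ ∈ selmerGroup W (lvl M), ∀ s₂ ∈ selmerGroup (twin W K) (lvl M),
    rK₁ W K M s₁ + rK₂ W M hθ hθsq s₂ = 0 → s₁ = 0 ∧ s₂ = 0
  /-- **Cor. 3.2, visible form**, for pure families independent after `rK₁ + rK₂`. -/
  cebotarev : ∀ (r : ℕ) (cs : Fin r → galH1Torsion W (lvl M) × galH1Torsion (twin W K) (lvl M))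
    (Nv : Fin r → ℕ), (∀ i, cs i ≠ 0) → (∀ i, Nv i ≠ 0 → ((2 : ℤ) ^ (Nv i - 1)) • cs i ≠ 0) →
    (∀ i, (cs i).2 = 0 ∨ (cs i).1 = 0) →
    (∀ a : Fin r → ℤ, ∑ i, a i • (rK₁ W K M (cs i).1 + rK₂ W M hθ hθsq (cs i).2) = 0 → ∀ i, a i • cs i = 0) →
    ∀ b : ℕ, ∃ ℓ, b < ℓ ∧ kolPrime W K M ℓ ∧ ∀ i, ((2 : ℤ) ^ Nv i) • cs i ∈ (a₁ W M ℓ).prod (a₂ W K M ℓ) ∧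
      (Nv i ≠ 0 → ((2 : ℤ) ^ (Nv i - 1)) • cs i ∉ (a₁ W M ℓ).prod (a₂ W K M ℓ))

/-! ## §3 Unfolding lemmas and the derived axioms -/

section Derived

variable {W : WeierstrassCurve ℚ} [W.IsElliptic] [W.IsGloballyMinimal] {K : Type} [Field K] [NumberField K]
  {M : ℕ} {θ : K} {hθ : θ ∉ Set.range (algebraMap ℚ K)}
  {hθsq : θ ^ 2 = algebraMap ℚ K ((NumberField.discr K : ℤ) : ℚ)}

omit [W.IsElliptic] [W.IsGloballyMinimal] in
/-- `pl ℓ = v_ℓ` for `ℓ` prime. [folklore] -/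
theorem pl_of_prime {ℓ : ℕ} (hℓ : ℓ.Prime) :
    pl ℓ = Sum.inl (primesEquiv.symm ⟨ℓ, hℓ⟩ : HeightOneSpectrum (𝓞 ℚ)) :=
  dif_pos hℓ

omit [W.IsElliptic] [W.IsGloballyMinimal] in
/-- Membership in `a₁ ℓ` for `ℓ` prime: the strict condition at `v_ℓ`. [folklore] -/
theorem mem_a₁_iff {ℓ : ℕ} (hℓ : ℓ.Prime) (u : galH1Torsion W (lvl M)) :
    u ∈ a₁ W M ℓ ↔ u ∈ W.torsionLocalKer
      ((primesEquiv.symm ⟨ℓ, hℓ⟩ : HeightOneSpectrum (𝓞 ℚ)).adicCompletion ℚ) (lvl M) := by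
  simp only [a₁, AddSubgroup.mem_iInf]
  exact ⟨fun h ↦ h _ (natCast_mem_primesEquiv_symm hℓ),
    fun h v hv ↦ by rwa [(natCast_prime_mem_iff_eq hℓ v).mp hv]⟩

omit [W.IsElliptic] [W.IsGloballyMinimal] in
/-- Membership in `a₂ ℓ` for `ℓ` prime. [folklore] -/
theorem mem_a₂_iff {ℓ : ℕ} (hℓ : ℓ.Prime) (y : galH1Torsion (twin W K) (lvl M)) :
    y ∈ a₂ W K M ℓ ↔ y ∈ (twin W K).torsionLocalKer
      ((primesEquiv.symm ⟨ℓ, hℓ⟩ : HeightOneSpectrum (𝓞 ℚ)).adicCompletion ℚ) (lvl M) := by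
  simp only [a₂, AddSubgroup.mem_iInf]
  exact ⟨fun h ↦ h _ (natCast_mem_primesEquiv_symm hℓ),
    fun h v hv ↦ by rwa [(natCast_prime_mem_iff_eq hℓ v).mp hv]⟩

omit [W.IsElliptic] [W.IsGloballyMinimal] in
/-- Membership in `locK ℓ`. [folklore] -/
theorem mem_locK_iff (ℓ : ℕ) (f : HK W K M) :
    f ∈ locK W K M ℓ ↔ ∀ w : HeightOneSpectrum (𝓞 K), (ℓ : 𝓞 K) ∈ w.asIdeal →
      ∀ 𝔔 ∈ w.primesAbove, ∀ ρ : torsionFixing (W.baseChange K) (lvl M),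
        (ρ : absoluteGaloisGroup K) ∈ 𝔔.inertia (absoluteGaloisGroup K) → f ρ = 0 := by
  simp only [locK, AddSubgroup.mem_iInf, AddMonoidHom.mem_ker, Pi.evalAddMonoidHom_apply]

omit [W.IsElliptic] [W.IsGloballyMinimal] in
/-- `rK₁ u ρ = [res u, ρ]`. [folklore] -/
theorem rK₁_apply (u : galH1Torsion W (lvl M)) (ρ : torsionFixing (W.baseChange K) (lvl M)) :
    rK₁ W K M u ρ = h1Eval (W.baseChange K) (lvl M) (resTorsion W K (lvl M) u) ρ := rfl

omit [W.IsElliptic] [W.IsGloballyMinimal] in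
/-- `rK₂ y ρ = [hPsiKT (res y), ρ]`. [folklore] -/
theorem rK₂_apply (y : galH1Torsion (twin W K) (lvl M)) (ρ : torsionFixing (W.baseChange K) (lvl M)) :
    rK₂ W M hθ hθsq y ρ = h1Eval (W.baseChange K) (lvl M)
      (hPsiKT W K hθ hθsq (lvl M) (resTorsion (twin W K) K (lvl M) y)) ρ := rfl

omit [W.IsElliptic] in
/-- The local data at the place `v_ℓ` of a Kolyvagin prime: `ℓ ∈ v_ℓ`, `2 ∉ v_ℓ`, `2^M ∉ v_ℓ`, `d_K ∉ v_ℓ`.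
[cite: GrossLMS1991, §3 (3.1)] -/
theorem local_data {ℓ : ℕ} (h : kolPrime W K M ℓ) :
    ∃ hℓ : ℓ.Prime, (ℓ : 𝓞 ℚ) ∈ (primesEquiv.symm ⟨ℓ, hℓ⟩ : HeightOneSpectrum (𝓞 ℚ)).asIdeal ∧
      (2 : 𝓞 ℚ) ∉ (primesEquiv.symm ⟨ℓ, hℓ⟩ : HeightOneSpectrum (𝓞 ℚ)).asIdeal ∧
      ((lvl M : ℤ) : 𝓞 ℚ) ∉ (primesEquiv.symm ⟨ℓ, hℓ⟩ : HeightOneSpectrum (𝓞 ℚ)).asIdeal ∧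
      ((NumberField.discr K : ℤ) : 𝓞 ℚ) ∉ (primesEquiv.symm ⟨ℓ, hℓ⟩ : HeightOneSpectrum (𝓞 ℚ)).asIdeal := by
  obtain ⟨hℓ, hℓ2, hℓd, -⟩ := h
  obtain ⟨h2v, hqv⟩ := two_notMem_and_natCast_two_pow_notMem (rfl : 2 ^ M = 2 ^ M) hℓ hℓ2
    (natCast_mem_primesEquiv_symm hℓ)
  exact ⟨hℓ, natCast_mem_primesEquiv_symm hℓ, h2v, hqv, intCast_notMem_of_not_dvd hℓ
    (natCast_mem_primesEquiv_symm hℓ) hℓd⟩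

omit [W.IsElliptic] [W.IsGloballyMinimal] in
/-- `θ ∉ ℚ` in the `RingHom.range` form used by `…SelmerDescentQuadratic`. [folklore] -/
theorem not_mem_range (hθ : θ ∉ Set.range (algebraMap ℚ K)) : θ ∉ (algebraMap ℚ K).range :=
  fun h ↦ hθ (Set.mem_range.mpr (RingHom.mem_range.mp h))

end Derived

end Summit.BirchSwinnertonDyer.BirchSwinnertonDyer.Theorems.GenusExact.VisiblePairAtTwo

end
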